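import Literature.AnabelianGeometry.EtaleTheta.Thm16SubdagTransport
import Literature.AnabelianGeometry.EtaleTheta.GalSectCuspReductionGlue
import Literature.AnabelianGeometry.EtaleTheta.XuuCocycleOfClassLevel
import HarnessLib

/-!
# [EtTh] Theorem 1.6 (iii) — sub-DAG row L00(iii), part 5: the core assembly with its `Π^tp_X`-stability input
# DISCHARGED and its «reduction of indeterminacy» input supplied by the cusp-evaluation glue (proof-only)

Mochizuki, *The étale theta function and its Frobenioid-theoretic manifestations*, Publ. RIMS **45** (2009),
Thm. 1.6 (iii), PRIMS PDF pp. 24–25 (printed 250–251): "The isomorphism of cohomology groups induced by `γ`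
maps the classes `O^×_{K̈α} · η̈^Θ_α` … to some `Π^tp_{Xβ}/Π^tp_{Yβ} ≅ Z`-conjugate of the corresponding classes
`O^×_{K̈β} · η̈^Θ_β`", proof p. 25 l.5–38 [cite: MochizukiEtTh2009, Thm 1.6 (iii) p.24]. abc-iut cell, layer L2,
sub-DAG `plan/L2/SUBDAG-EtTh-Thm16.md` (§K row K3; lineage abc-iut-L6-d5), PART 5 — PROOF-ONLY sequel of
`Thm16SubdagTransport.lean` (p417878, file (C)) and of abc-iut-w5-d062's `GalSectCuspReductionGlue.lean` (p422605).

File (C) proved `Thm16Sub.thm16iii_of_core`: `Thm16iii γ h c Eα Eβ hCβ` from three inputs —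
(hunits) units transported to units (`κ(O^×_{K̈α}) ↦ κ(O^×_{K̈β})`, Thm 1.6 (ii) clause (b), row L11),
(hconj) the unit classes `κ(O^×_{K̈β})` are stable under conjugation by `σ ∈ Π^tp_{Xβ}`, and
(heta) the core identity `transport(η̈^Θ_α) ∈ κ(O^×_{K̈β}) · conj_σ(η̈^Θ_β)` (rows L12–L15).  THIS FILE:
* `Thm16Sub.kumUnitsYdd_map_conj_eq` — (hconj) DISCHARGED: `κ(O^×_K̈)` is even FIXED POINTWISE by every
  `σ ∈ Π^tp_X` (abc-iut-w5-d234 / `XuuCocycleOfClassLevel`'s `conj_eq_self_of_mem_kumUnitsYdd`: Prop. 1.5 (ii)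
  `F̈² = κ((K̈^×)^∧)` on which `Π^tp_X` acts through `G_K`, and `G_K = G_K̈` under the §2 standing hypotheses
  `Sec2Hyps`), inputs BY NAME: `Dβ.Compat`, `Dβ.Sec2Hyps`, `Prop15ii`;
* `Thm16Sub.thm16iii_of_core_of_sec2Hyps` — the core assembly with (hconj) replaced by those inputs;
* `Thm16Sub.thm16iii_of_cuspValues` — the core assembly with, IN ADDITION, (heta) replaced by its printed
  derivation «reduction of indeterminacy from `(K̈^×)^∧` to `O^×_K̈`» (p. 25 l.31–38): the rows L12–L14 output
  `transport(η̈^Θ_α) = κ(a) · conj_σ(η̈^Θ_β)` for SOME `a ∈ (K̈^×)^∧`, plus a `K̈`-rational cusp `y` of `Ÿ` with its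
  canonical-integral-structure section (w5-d062's carrier `CuspidalPointDd`, p419967) at which BOTH classes
  evaluate to `O^×_K̈`-multiples of values of equal absolute value (Prop. 1.4 (iii) cusp clause on the β-side and
  its transport along `γ`; hypotheses `h₁`, `h₂`, `hu₁`, `hu₂`, `hv`), give (heta) by
  `CuspidalPointDd.exists_mem_kumUnitsYdd_mul_of_cuspValues` (p422605) — hence `Thm16iii`.
HONEST RESIDUAL of [EtTh] Thm. 1.6 (iii) after this file = exactly the binders of `thm16iii_of_cuspValues`:
Thm 1.6 (i) `h` + a theta companion `c` (rows L01–L10, kernel-closed modulo their own named inputs), (hunits)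
= Thm 1.6 (ii) (b) (row L11, [AbsAnab] Prop. 1.2.1 (vii)), the factor relation (rows L12–L14: [SemiAnbd] Thm 6.8
(ii) inversion compatibility + Prop. 1.5 (iii)), and the two cusp evaluations (Prop. 1.4 (iii) cusp clause,
[GalSect] §4 — sub-DAG debt R5, now carried by w5-d062's `CuspidalPointDd`). No `def`, no new `Prop`, no
instance; [EtTh] is refereed and undisputed; nothing here bears on [IUTchIII] Cor. 3.12; typed ≠ proved.
-/

noncomputable section

namespace Literature.AnabelianGeometry.EtaleTheta

open Literature.AnabelianGeometry.SemiGraphs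

namespace Thm16Sub

variable {p : ℕ} [Fact p.Prime] {Dα Dβ : ThetaSetting p} {γ : Dα.PiTemp ≃ₜ* Dβ.PiTemp}

/-! ### (hconj) discharged: `κ(O^×_K̈) ⊆ H¹(Π^tp_Ÿ, Δ_Θ)` is pointwise fixed by `Π^tp_X` -/

/-- **`Π^tp_X`-stability of the unit classes** ([EtTh] Thm. 1.6 (iii) proof p. 25; input (hconj) of
`thm16iii_of_core`): for every `σ ∈ Π^tp_X`, conjugation by `σ` maps `κ(O^×_K̈)` onto itself — indeed fixes it
pointwise (`ThetaSetting.EtaleThetaData.conj_eq_self_of_mem_kumUnitsYdd`: Prop. 1.5 (ii) `F̈² = κ((K̈^×)^∧)`, on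
which `Π^tp_X` acts through `G_K = G_K̈`). Inputs BY NAME: `Compat`, `Sec2Hyps`, `Prop15ii`.
[cite: MochizukiEtTh2009, Thm 1.6 (iii) p.25] -/
theorem kumUnitsYdd_map_conj_eq (E : Dβ.EtaleThetaData) (hC : Dβ.Compat) (hS : Dβ.Sec2Hyps)
    (h15ii : ThetaSetting.Prop15ii E.toKummerData hC) (σ : Dβ.PiTemp) :
    haveI := hC.GtpYdd_normal
    E.kumUnitsYdd.map (ContH1.conj Dβ.toTheta Dβ.DeltaTheta σ) = E.kumUnitsYdd := by
  haveI := hC.GtpYdd_normal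
  ext k
  constructor
  · rintro ⟨k', hk', rfl⟩
    rw [ThetaSetting.EtaleThetaData.conj_eq_self_of_mem_kumUnitsYdd hC hS h15ii hk' σ]
    exact hk'
  · intro hk
    exact ⟨k, hk, ThetaSetting.EtaleThetaData.conj_eq_self_of_mem_kumUnitsYdd hC hS h15ii hk σ⟩

/-- In particular every `Π^tp_X/Π^tp_Y ≅ Z`-conjugate of a theta class `k · η̈^Θ` (`k ∈ κ(O^×_K̈)`) is
`k · conj_σ(η̈^Θ)`: the conjugation indeterminacy of Thm. 1.6 (iii) acts on `η̈^Θ` alone.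
[cite: MochizukiEtTh2009, Thm 1.6 (iii) p.24] -/
theorem conj_mul_etaDd_of_mem_kumUnitsYdd (E : Dβ.EtaleThetaData) (hC : Dβ.Compat) (hS : Dβ.Sec2Hyps)
    (h15ii : ThetaSetting.Prop15ii E.toKummerData hC) (σ : Dβ.PiTemp) {k : Dβ.H1 Dβ.GtpYdd}
    (hk : k ∈ E.kumUnitsYdd) :
    haveI := hC.GtpYdd_normal
    ContH1.conj Dβ.toTheta Dβ.DeltaTheta σ (k * E.etaDd) =
      k * ContH1.conj Dβ.toTheta Dβ.DeltaTheta σ E.etaDd := by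
  haveI := hC.GtpYdd_normal
  rw [map_mul, ThetaSetting.EtaleThetaData.conj_eq_self_of_mem_kumUnitsYdd hC hS h15ii hk σ]

/-! ### Thm. 1.6 (iii) from the core identity, (hconj) supplied -/

/-- **[EtTh] Thm. 1.6 (iii) from the core identity, with the `Π^tp_X`-stability of the unit classes SUPPLIED**
(file (C)'s `thm16iii_of_core` ∘ `kumUnitsYdd_map_conj_eq`): inputs (hunits) = Thm 1.6 (ii) (b) (row L11) and
(heta) = the core identity `transport(η̈^Θ_α) ∈ κ(O^×_{K̈β}) · conj_σ(η̈^Θ_β)` (rows L12–L15), plus the standing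
§1/§2 inputs of the β-datum BY NAME (`Compat`, `Sec2Hyps`, `Prop15ii`). [cite: MochizukiEtTh2009, Thm 1.6 (iii) p.24] -/
theorem thm16iii_of_core_of_sec2Hyps (h : ThetaSetting.Thm16i γ) (c : ThetaSetting.ThetaCompanion γ)
    (Eα : Dα.EtaleThetaData) (Eβ : Dβ.EtaleThetaData) (hCβ : Dβ.Compat) (hSβ : Dβ.Sec2Hyps)
    (h15ii : ThetaSetting.Prop15ii Eβ.toKummerData hCβ) (σ : Dβ.PiTemp)
    (hunits : Eα.kumUnitsYdd.map (ThetaSetting.transport c h) = Eβ.kumUnitsYdd)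
    (heta : haveI := hCβ.GtpYdd_normal
      ∃ u ∈ Eβ.kumUnitsYdd, ThetaSetting.transport c h Eα.etaDd =
        u * ContH1.conj Dβ.toTheta Dβ.DeltaTheta σ Eβ.etaDd) :
    ThetaSetting.Thm16iii γ h c Eα Eβ hCβ :=
  thm16iii_of_core h c Eα Eβ hCβ σ hunits (kumUnitsYdd_map_conj_eq Eβ hCβ hSβ h15ii σ) heta

/-! ### Thm. 1.6 (iii) with the «reduction of indeterminacy» step supplied by cusp evaluation -/

/-- **[EtTh] Thm. 1.6 (iii), assembled down to print-shaped inputs** (proof p. 25 l.5–38): given Thm 1.6 (i)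
`h`, a theta companion `c`, the β-side standing inputs (`Compat`, `Sec2Hyps`, `Prop15ii`), (hunits) = Thm 1.6
(ii) (b), the rows L12–L14 output «`transport(η̈^Θ_α) = κ(a) · conj_σ(η̈^Θ_β)` for some `a ∈ (K̈^×)^∧`» (`hx`), and a
`K̈`-rational cusp `y` of `Ÿβ` with its section compatible with the canonical integral structure at which BOTH
classes evaluate to `O^×_K̈`-multiples `uᵢ·vᵢ` of values with `‖v₁‖ = ‖v₂‖` (Prop. 1.4 (iii) cusp clause for
`η̈^Θ_β` and its transport along `γ`: `h₁`, `h₂`), the «reduction of indeterminacy from `(K̈^×)^∧` to `O^×_K̈`»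
(abc-iut-w5-d062's `CuspidalPointDd.exists_mem_kumUnitsYdd_mul_of_cuspValues`) yields the core identity and
hence `Thm16iii γ h c Eα Eβ hCβ`. [cite: MochizukiEtTh2009, Thm 1.6 (iii) p.25] -/
theorem thm16iii_of_cuspValues (h : ThetaSetting.Thm16i γ) (c : ThetaSetting.ThetaCompanion γ)
    (Eα : Dα.EtaleThetaData) (Eβ : Dβ.EtaleThetaData) (hCβ : Dβ.Compat) (hSβ : Dβ.Sec2Hyps)
    (h15ii : ThetaSetting.Prop15ii Eβ.toKummerData hCβ) (σ : Dβ.PiTemp)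
    (hunits : Eα.kumUnitsYdd.map (ThetaSetting.transport c h) = Eβ.kumUnitsYdd)
    (a : Eβ.KddHat)
    (hx : haveI := hCβ.GtpYdd_normal
      ThetaSetting.transport c h Eα.etaDd =
        Dβ.inflTheta Dβ.GtpYdd (Eβ.kumYdd a) * ContH1.conj Dβ.toTheta Dβ.DeltaTheta σ Eβ.etaDd)
    (y : ThetaSetting.CuspidalPointDd Eβ.toKummerData) {u₁ u₂ v₁ v₂ : (↥Dβ.Kdd)ˣ}
    (hu₁ : u₁ ∈ Dβ.unitsOKdd) (hu₂ : u₂ ∈ Dβ.unitsOKdd)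
    (hv : ‖((v₁ : Dβ.Kdd) : PadicAlgCl p)‖ = ‖((v₂ : Dβ.Kdd) : PadicAlgCl p)‖)
    (h₁ : haveI := hCβ.GtpYdd_normal
      y.evalAt (ContH1.res Dβ.toTheta Dβ.DeltaTheta (y.sec_le.trans y.Dpt_le)
        (ContH1.conj Dβ.toTheta Dβ.DeltaTheta σ Eβ.etaDd)) = Eβ.toKddHat (u₁ * v₁))
    (h₂ : y.evalAt (ContH1.res Dβ.toTheta Dβ.DeltaTheta (y.sec_le.trans y.Dpt_le)
        (ThetaSetting.transport c h Eα.etaDd)) = Eβ.toKddHat (u₂ * v₂)) :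
    ThetaSetting.Thm16iii γ h c Eα Eβ hCβ :=
  haveI := hCβ.GtpYdd_normal
  thm16iii_of_core_of_sec2Hyps h c Eα Eβ hCβ hSβ h15ii σ hunits
    (y.exists_mem_kumUnitsYdd_mul_of_cuspValues a hx hu₁ hu₂ hv h₁ h₂)

end Thm16Sub

end Literature.AnabelianGeometry.EtaleTheta

end
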